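import Mathlib
import HarnessLib
import Summits.NavierStokesRegularity.NavierStokesRegularity.Theorems.HalfSpaceWindowDoorCirculationCarryingRigidityRotHeadCensus
import Summits.NavierStokesRegularity.NavierStokesRegularity.Theorems.PoloidalWindowDoorPoloidalWindowRigidityClassSpaceTimeRates
import Literature.Analysis.FluidPDE.TypeIAncientMildClassical

/-!
# Route `HalfSpaceWindowDoor`, crux `CirculationCarryingRigidity` (stmt-NavierStokesRegularity-25311) — line
# `rot_bernoulli`, V: INSTANTANEOUS counter-rotating self-similarity at ONE time already kills

LEAD ns-hsw-p1 g11 (cell pub-ns-dss).  The census row of `…RotHeadCensus` assumed that the time `−1` slice of the profile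
solves the rotated Leray system with SOME `C²`, polynomially bounded pressure.  Here both the system and the pressure are
produced FROM THE CLASS: a door-class profile is classical on every window `(t₀, 0)` for some smooth pressure `p`
(`IsTypeIAncientMild.exists_isClassicalNSSolutionOn_Ioo`), every such pressure has `‖∇p(t,·)‖ ≤ K/((−t)√(−t))`
(`…ClassSpaceTimeRates.exists_pressureGradient_rate_of_class`), hence `p(−1,·)` grows at most linearly, and the momentum
equation at `t = −1` turns the single KINEMATIC hypothesis

  `∂ₜv(−1, y) = ½ v(−1,y) + ½ (y·∇)v(−1,y) + α (e₃ × v(−1,y) − ((e₃×y)·∇) v(−1,y))`   for all `y`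

— the infinitesimal form of rotated self-similarity `v(x,t) = (−t)^{−1/2} R(αs) U(R(−αs)x/√(−t))` (Pineau–Vicol (1.7)),
imposed at the ONE instant `t = −1` only — into the rotated Leray system (1.8) for `U = v(−1)`, `P = p(−1)`.  Hence:

* `eq_zero_of_instantRSS` — door class + closed hemisphere `⟪curl v, e₃⟫ ≥ 0` + instantaneous rotated self-similarity at
  `t = −1` with angular speed `α ≤ 0` ⇒ `v ≡ 0` on the slab;
* `inner_curl_e3_eq_zero_of_instantRSS`, `not_isBackwardSingularPoint_of_instantRSS`, `hemisphereLiouvilleE3_of_instantRSS`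
  (W6 restricted, hypotheses verbatim + the one-instant identity), `alpha_pos_of_instantRSS_ne_zero` (ENEMY FORM: a non-zero
  closed-hemisphere profile that is instantaneously rotated-self-similar at some instant co-rotates there, `α > 0`).

(Genuinely RSS profiles satisfy the identity at every `t < 0`; by the scaling and time-shift covariance of the class the
instant `−1` is no restriction.)

WHAT THIS IS NOT: not a statement about Navier–Stokes regularity (Clay A); the door statements concern HYPOTHETICAL blow-up
profiles (KNSS ancient mild solutions); helper `--supports` 25311; the item stays OPEN at its research stub.
-/

noncomputable section

-- the summit and its single sub-problem share the name (CONVENTIONS §1), as in every Theorems file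
set_option linter.dupNamespace false

namespace Summit.NavierStokesRegularity.NavierStokesRegularity.Theorems.HalfSpaceWindowDoorCirculationCarryingRigidityRotHeadInstant

open Set Function Filter Topology InnerProductSpace
open scoped RealInnerProductSpace Laplacian ContDiff
open Literature.Analysis Literature.Analysis.FluidPDE
open Summit.NavierStokesRegularity.NavierStokesRegularity.Theorems.HalfSpaceWindowDoorCirculationCarryingRigidityDefs
  (InDoorClass SignE3 e3 HemisphereLiouvilleE3)
open Summit.NavierStokesRegularity.NavierStokesRegularity.Theorems.HalfSpaceWindowDoorCirculationCarryingRigidityRotHeadCensus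
  (eq_zero_of_rotProfile_slice)
open Summit.NavierStokesRegularity.NavierStokesRegularity.Theorems.PoloidalWindowDoorPoloidalWindowRigidityWindow
  (isTypeIAncientMild_of_class)
open Summit.NavierStokesRegularity.NavierStokesRegularity.Theorems.PoloidalWindowDoorPoloidalWindowRigidityClassSpaceTimeRates
  (exists_pressureGradient_rate_of_class)
open Summit.NavierStokesRegularity.NavierStokesRegularity.Theorems.PoloidalWindowDoorPoloidalWindowRigidityFlat
  (not_backwardSingular_of_zero)

variable {C : ℝ} {v : ℝ → EuclideanSpace ℝ (Fin 3) → EuclideanSpace ℝ (Fin 3)}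

/-- **Linear growth from a gradient bound**: a differentiable `P : E → ℝ` with `‖∇P‖ ≤ K` satisfies
`|P y| ≤ (|P 0| + K)(1 + ‖y‖)`. -/
theorem abs_le_of_gradient_bound {P : EuclideanSpace ℝ (Fin 3) → ℝ} {K : ℝ} (hP : Differentiable ℝ P) (hK : 0 ≤ K)
    (hgrad : ∀ y, ‖gradient P y‖ ≤ K) (y : EuclideanSpace ℝ (Fin 3)) :
    |P y| ≤ (|P 0| + K) * (1 + ‖y‖) ^ 1 := by
  have hfd : ∀ z, ‖fderiv ℝ P z‖ ≤ K := fun z => by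
    refine ContinuousLinearMap.opNorm_le_bound _ hK fun w => ?_
    have h : fderiv ℝ P z w = ⟪gradient P z, w⟫ := by
      rw [gradient, InnerProductSpace.toDual_symm_apply]
    rw [h]
    exact (abs_real_inner_le_norm _ _).trans (mul_le_mul_of_nonneg_right (hgrad z) (norm_nonneg _))
  have hmv : ‖P y - P 0‖ ≤ K * ‖y - 0‖ :=
    (convex_univ).norm_image_sub_le_of_norm_fderiv_le (fun z _ => hP z) (fun z _ => hfd z) (mem_univ 0) (mem_univ y)
  rw [sub_zero, Real.norm_eq_abs] at hmv
  have h1 : |P y| ≤ |P 0| + K * ‖y‖ := by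
    have := abs_sub_abs_le_abs_sub (P y) (P 0)
    linarith
  have hy : 0 ≤ ‖y‖ := norm_nonneg y
  rw [pow_one]
  nlinarith [abs_nonneg (P 0)]

/-- **Instantaneous counter-rotating self-similarity kills.**  Let `v` be a door-class profile with `⟪curl v(s), e₃⟫ ≥ 0`
on the slab, and suppose that at the single instant `t = −1` its time derivative is the rotated-self-similar generator,
`∂ₜv(−1,y) = ½v(−1,y) + ½(y·∇)v(−1,y) + α(e₃×v(−1,y) − ((e₃×y)·∇)v(−1,y))` for all `y`, with `α ≤ 0`.  Then `v ≡ 0`. -/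
theorem eq_zero_of_instantRSS (hv : InDoorClass C v) (hsign : SignE3 v) {α : ℝ} (hα : α ≤ 0)
    (hgen : ∀ y, deriv (fun τ => v τ y) (-1) = (1 / 2 : ℝ) • v (-1) y + (1 / 2 : ℝ) • fderiv ℝ (v (-1)) y y +
      α • (rotGen (v (-1) y) - fderiv ℝ (v (-1)) y (rotGen y))) :
    ∀ t < 0, ∀ x, v t x = 0 := by
  obtain ⟨hrate, hcont, hmild, hdiv⟩ := hv
  have hA : IsTypeIAncientMild C v := isTypeIAncientMild_of_class hrate hcont hmild hdiv
  have h1 : (-1 : ℝ) < 0 := by norm_num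
  have hmem : (-1 : ℝ) ∈ Ioo (-2 : ℝ) 0 := ⟨by norm_num, by norm_num⟩
  -- a classical pressure on the window `(−2, 0)` and its gradient rate
  obtain ⟨p, hns⟩ := hA.exists_isClassicalNSSolutionOn_Ioo (t₀ := -2) (by norm_num)
  obtain ⟨K, hK0, hK⟩ := exists_pressureGradient_rate_of_class hrate hcont hmild
  have hgradK : ∀ y, ‖gradient (p (-1)) y‖ ≤ K := fun y => by
    have h := hK (-2) p hns (-1) hmem y
    rwa [neg_neg, Real.sqrt_one, mul_one, div_one] at h
  have hP : ContDiff ℝ 2 (p (-1)) := (hns.contDiff_pressure hmem).of_le (by norm_cast)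
  have hPd : Differentiable ℝ (p (-1)) := (hP.of_le one_le_two).differentiable one_ne_zero
  have hPpoly : ∃ K' : ℝ, ∃ N : ℕ, ∀ y, |p (-1) y| ≤ K' * (1 + ‖y‖) ^ N :=
    ⟨|p (-1) 0| + K, 1, abs_le_of_gradient_bound hPd hK0 hgradK⟩
  -- the momentum equation at `t = −1`, with the time derivative replaced by the generator
  have hprof : ∀ y, -((Δ (v (-1))) y) + (1 / 2 : ℝ) • v (-1) y + (1 / 2 : ℝ) • fderiv ℝ (v (-1)) y y +
      convect (v (-1)) (v (-1)) y + gradient (p (-1)) y +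
      α • (rotGen (v (-1) y) - fderiv ℝ (v (-1)) y (rotGen y)) = 0 := fun y => by
    have hmom := hns.momentum (-1) hmem y
    simp only [one_smul, Pi.zero_apply, add_zero] at hmom
    have htd : timeDerivWithin (Ioo (-2 : ℝ) 0) v (-1) y = deriv (fun τ => v τ y) (-1) := by
      rw [timeDerivWithin, derivWithin_of_isOpen isOpen_Ioo hmem]
    rw [htd, hgen y] at hmom
    rw [← sub_eq_zero] at hmom
    rw [← hmom]
    abel
  exact eq_zero_of_rotProfile_slice ⟨hrate, hcont, hmild, hdiv⟩ hsign hα hP hPpoly hprof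

/-- Hence such a profile is POLOIDAL along `e₃` (indeed zero). -/
theorem inner_curl_e3_eq_zero_of_instantRSS (hv : InDoorClass C v) (hsign : SignE3 v) {α : ℝ} (hα : α ≤ 0)
    (hgen : ∀ y, deriv (fun τ => v τ y) (-1) = (1 / 2 : ℝ) • v (-1) y + (1 / 2 : ℝ) • fderiv ℝ (v (-1)) y y +
      α • (rotGen (v (-1) y) - fderiv ℝ (v (-1)) y (rotGen y))) :
    ∀ s < 0, ∀ y, ⟪curl (v s) y, e3⟫ = 0 := by
  intro s hs y
  have hz : v s = 0 := funext fun x => eq_zero_of_instantRSS hv hsign hα hgen s hs x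
  rw [hz, curl_zero]
  simp

/-- … and NOT backward singular at the apex. -/
theorem not_isBackwardSingularPoint_of_instantRSS (hv : InDoorClass C v) (hsign : SignE3 v) {α : ℝ} (hα : α ≤ 0)
    (hgen : ∀ y, deriv (fun τ => v τ y) (-1) = (1 / 2 : ℝ) • v (-1) y + (1 / 2 : ℝ) • fderiv ℝ (v (-1)) y y +
      α • (rotGen (v (-1) y) - fderiv ℝ (v (-1)) y (rotGen y))) :
    ¬ IsBackwardSingularPoint v 0 :=
  not_backwardSingular_of_zero (eq_zero_of_instantRSS hv hsign hα hgen)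

/-- **W6 = `HemisphereLiouvilleE3` RESTRICTED TO INSTANTANEOUSLY COUNTER-ROTATING-SELF-SIMILAR PROFILES** (the hypotheses of
`HemisphereLiouvilleE3` verbatim, plus the one-instant identity with `α ≤ 0`). -/
theorem hemisphereLiouvilleE3_of_instantRSS (C : ℝ) (v : ℝ → EuclideanSpace ℝ (Fin 3) → EuclideanSpace ℝ (Fin 3))
    (hrate : HasTypeITimeDecay C v) (hcont : ContinuousOn (Function.uncurry v) (Set.Iio (0 : ℝ) ×ˢ Set.univ))
    (hmild : ∀ s t : ℝ, s < t → t < 0 → ∀ x,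
      v t x = UnboundedOperators.heatExtension (v s) (t - s) x - oseenDuhamel 1 s v v t x)
    (hdiv : ∀ t < 0, VectorCalculus.IsDivFree (v t)) (hsign : ∀ s < 0, ∀ y, 0 ≤ ⟪curl (v s) y, e3⟫)
    {α : ℝ} (hα : α ≤ 0)
    (hgen : ∀ y, deriv (fun τ => v τ y) (-1) = (1 / 2 : ℝ) • v (-1) y + (1 / 2 : ℝ) • fderiv ℝ (v (-1)) y y +
      α • (rotGen (v (-1) y) - fderiv ℝ (v (-1)) y (rotGen y))) :
    ∀ s < 0, ∀ y, ⟪curl (v s) y, e3⟫ = 0 :=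
  inner_curl_e3_eq_zero_of_instantRSS ⟨hrate, hcont, hmild, hdiv⟩ hsign hα hgen

/-- **ENEMY FORM.**  A closed-hemisphere door-class profile with a non-zero value which is instantaneously rotated-self-similar
at `t = −1` with angular speed `α` has `α > 0`: it CO-ROTATES with its vertical vorticity. -/
theorem alpha_pos_of_instantRSS_ne_zero (hv : InDoorClass C v) (hsign : SignE3 v) (hne : ∃ t < 0, ∃ x, v t x ≠ 0)
    {α : ℝ}
    (hgen : ∀ y, deriv (fun τ => v τ y) (-1) = (1 / 2 : ℝ) • v (-1) y + (1 / 2 : ℝ) • fderiv ℝ (v (-1)) y y +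
      α • (rotGen (v (-1) y) - fderiv ℝ (v (-1)) y (rotGen y))) :
    0 < α := by
  by_contra hle
  push Not at hle
  obtain ⟨t, ht, x, hx⟩ := hne
  exact hx (eq_zero_of_instantRSS hv hsign hle hgen t ht x)

end Summit.NavierStokesRegularity.NavierStokesRegularity.Theorems.HalfSpaceWindowDoorCirculationCarryingRigidityRotHeadInstant

end
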